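import Literature.AlgebraicGeometry.Frobenioids.PerfectionPullbackMorphisms
import Literature.AlgebraicGeometry.Frobenioids.PerfectionProp32iii
import HarnessLib

/-!
# Frobenioids I, Proposition 3.2 (i) [divisor component], (ii) [remaining classes], (iii): the two
# closures of the typed schemata `Prop32i_div`, `Prop32ii_rest`, `Prop32iii` (PROOFS)

Mochizuki, *The geometry of Frobenioids I: the general theory*, Kyushu J. Math. **62** (2008)
293–400, Proposition 3.2 pp. 58–59 [cite: MochizukiFrdI2008, Prop. 3.2 p.58]: "(i) The pre-Frobenioid
`C^pf` … [fits into] a natural 1-commutative diagram … where … the lower horizontal arrow is induced by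
the natural morphism of monoids `Φ → Φ^pf`. (ii) An arrow of `C^pf` is a(n) … base-identity endomorphism;
… pull-back morphism … if and only if a cofinal collection of the system of arrows of `C` that determine
this arrow of `C^pf` is so. (iii) … `C^pf` … is a Frobenioid of perfect and isotropic type. Moreover, there
is a natural equivalence of categories `C^pf ⥲ (C^pf)^pf`."

PROOF-ONLY companion of `BaseCategoryTheoreticityDefs.lean` (seat abc-iut-L1-t3) for the abc-iut cell's
frozen fact rows F-0910 (`Prop32i_div`), F-0912 (`Prop32ii_rest`), F-0913 (`Prop32iii`) — no definition,
no statement of that file is edited or restated.  The three declarations are SCHEMATA over the data-only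
interface `PerfectionData S` (whose docstring warns: "never quantify universally over them — a junk datum
refutes any such `∀`"), so each row has two kernel-checkable closures:

* the closure over the INTERFACE binders (all operations `S`, all data `P : PerfectionData S`, all maps
  `ι`, all data `PP`) is FALSE — `not_forall_prop32i_div`, `not_forall_prop32ii_rest`,
  `not_forall_prop32iii` — by one explicit junk datum over the one-object category of the monoid
  `N_{≥1}` (`exists_junk_perfectionData`: base functor collapsing every arrow to the identity, the
  "perfection" being the identity functor to a copy whose base functor is the identity and all of whose
  Frobenius degrees are `1`).  This is an artefact of the interface carrying no axioms, not a statement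
  about perfections of Frobenioids; it certifies that no file may bind such a universal closure as a
  hypothesis without becoming vacuous;
* the closure over the PRINTED binders — every Frobenioid `C → F_Φ` (of Frobenius-isotropic type for
  (iii), the standing hypothesis of Def. 3.1 (ii) p. 56), THE perfection `C^pf` of Def. 3.1 (iii)
  (`PreFrobenioidData.perfection hF`, seat abc-iut-L1-d9), the natural map `Φ → Φ^pf`
  (`Frobenioids.Perfection.of`), and for (iii) THE perfection of the Frobenioid `C^pf` — HOLDS:
  `prop32i_div_holds`, `prop32ii_rest_holds`, `prop32iii_holds`.  These are the landed instance theorems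
  `PreFrobenioid.Perfection.prop32i_div_perfection`, `….prop32ii_rest_perfection`
  (`PerfectionPullbackMorphisms.lean`) and `….prop32iii_perfection` (`PerfectionProp32iii.lean`) BY NAME,
  stated with the fully-qualified schema as conclusion head and closed over the printed binders.
Nothing here is specific to the abc programme; no statement of the paper is strengthened or weakened.
-/

namespace Literature.AlgebraicGeometry.Frobenioids

open CategoryTheory Opposite

universe w v v' u u'

/-! ### The closure over the printed binders: THE perfection of a Frobenioid -/

section Printed

variable {D : Type u} [Category.{v} D] {Φ : Dᵒᵖ ⥤ CommMonCat.{w}}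
  {C : Type u'} [Category.{v'} C] {F : C ⥤ ElemFrobenioid Φ}

/-- **Proposition 3.2 (i), divisor component of the 1-commutative square** (fact row F-0910), closed over
the printed binders: for every Frobenioid `F : C → F_Φ`, THE perfection `C → C^pf` carries `Div(φ)` to
`Div((A,1) → (B,1))` along the natural map `Φ(X) → Φ(X)^pf` — the landed theorem
`PreFrobenioid.Perfection.prop32i_div_perfection` BY NAME (FrdI Prop. 3.2 (i) pp. 58–59).  The closure over
the interface binders is false: `not_forall_prop32i_div`. [cite: MochizukiFrdI2008, Prop. 3.2 (i) p.58] -/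
theorem prop32i_div_holds (hF : PreFrobenioid.IsFrobenioid F) :
    Literature.AlgebraicGeometry.Frobenioids.Prop32i_div (PreFrobenioidData.ofFunctor Φ F)
      (PreFrobenioidData.perfection hF) (fun X => Frobenioids.Perfection.of (Φ.obj (op X))) :=
  PreFrobenioid.Perfection.prop32i_div_perfection hF

/-- **Proposition 3.2 (ii), base-identity endomorphisms and pull-back morphisms** (fact row F-0912),
closed over the printed binders: for every Frobenioid `F : C → F_Φ`, THE functor `C → C^pf` carries
base-identity endomorphisms to base-identity endomorphisms and pull-back morphisms to pull-back morphisms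
— the landed theorem `PreFrobenioid.Perfection.prop32ii_rest_perfection` BY NAME (FrdI Prop. 3.2 (ii)
p. 59).  The closure over the interface binders is false: `not_forall_prop32ii_rest`.
[cite: MochizukiFrdI2008, Prop. 3.2 (ii) p.59] -/
theorem prop32ii_rest_holds (hF : PreFrobenioid.IsFrobenioid F) :
    Literature.AlgebraicGeometry.Frobenioids.Prop32ii_rest (PreFrobenioidData.ofFunctor Φ F)
      (PreFrobenioidData.perfection hF) :=
  PreFrobenioid.Perfection.prop32ii_rest_perfection hF

/-- **Proposition 3.2 (iii)** (fact row F-0913), closed over the printed binders: for every Frobenioid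
`F : C → F_Φ` of Frobenius-isotropic type (the standing hypothesis of Def. 3.1 (ii) under which `C^pf` is
defined in print), THE perfection `C^pf` is of perfect type and of isotropic type, and THE functor
`C^pf → (C^pf)^pf` to the perfection of the Frobenioid `C^pf` is an equivalence of categories — the landed
theorem `PreFrobenioid.Perfection.prop32iii_perfection` BY NAME (FrdI Prop. 3.2 (iii) p. 59).  The closure
over the interface binders is false: `not_forall_prop32iii`. [cite: MochizukiFrdI2008, Prop. 3.2 (iii) p.59] -/
theorem prop32iii_holds (hF : PreFrobenioid.IsFrobenioid F)
    (hiso : PreFrobenioid.IsOfType (PreFrobenioid.IsFrobeniusIsotropic F)) :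
    Literature.AlgebraicGeometry.Frobenioids.Prop32iii (PreFrobenioidData.ofFunctor Φ F)
      (PreFrobenioidData.perfection hF)
      (PreFrobenioidData.perfection (PreFrobenioid.Perfection.isFrobenioid hF hiso)) :=
  PreFrobenioid.Perfection.prop32iii_perfection hF hiso

end Printed

/-! ### The closure over the interface binders is false: one junk perfection datum -/

/-- **Junk datum.**  On the one-object category `J` of the monoid `N_{≥1}` take the operations `S` with
base functor `J → J` collapsing every arrow to the identity, divisor monoid `N_{≥1}` with identity
pull-backs, all zero divisors trivial and all Frobenius degrees `1`; and the "perfection datum" `P` whose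
category is `J` again, whose functor `C → C^pf` is the identity, and whose operations are those of `S`
except that the base functor is the IDENTITY of `J`.  Then: (i) no 1-commutation of the base functors
exists at all (naturality at the arrow `2` would force `η · 2 = η` in `N_{≥1}`), so `Prop32i_div S P ι`
fails for every `ι`; (ii) the arrow `2` is a base-identity endomorphism for `S` but not for `P.ops`, so
`Prop32ii_rest S P` fails; (iii) `P.ops` is not of perfect type (no arrow has Frobenius degree `2`), so
`Prop32iii S P PP` fails for every `PP`.  An artefact of the axiom-free interface `PerfectionData`.
[cite: MochizukiFrdI2008, Prop. 3.2 p.58] -/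
theorem exists_junk_perfectionData :
    ∃ (S : PreFrobenioidData.{0} (SingleObj ℕ+) (SingleObj ℕ+)) (P : PerfectionData S),
      (∀ ι : ∀ X : SingleObj ℕ+, S.Mon X →* P.ops.Mon X, ¬ Prop32i_div S P ι) ∧
        ¬ Prop32ii_rest S P ∧ ∀ PP : PerfectionData P.ops, ¬ Prop32iii S P PP := by
  -- the operations over a given base functor `B : J → J`
  let mk : (SingleObj ℕ+ ⥤ SingleObj ℕ+) → PreFrobenioidData.{0} (SingleObj ℕ+) (SingleObj ℕ+) :=
    fun B =>
      { base := B
        Mon := fun _ => ℕ+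
        pull := fun _ => MonoidHom.id ℕ+
        pull_id := fun _ _ => rfl
        pull_comp := fun _ _ _ => rfl
        div := fun _ => 1
        degFr := fun _ => 1
        div_id := fun _ => rfl
        div_comp := fun _ _ => by simp
        degFr_id := fun _ => rfl
        degFr_comp := fun _ _ => (mul_one _).symm }
  let S := mk (1 : ℕ+ →* ℕ+).toFunctor
  let P : PerfectionData S :=
    { Pf := SingleObj ℕ+
      toPf := 𝟭 _
      root := fun A _ => A
      root_one := fun _ => rfl
      root_surjective := fun X => ⟨X, 1, rfl⟩
      ops := mk (𝟭 _) }
  -- the arrow `2 : ⋆ → ⋆` of `J`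
  let two : SingleObj.star ℕ+ ⟶ SingleObj.star ℕ+ := (2 : ℕ+)
  refine ⟨S, P, ?_, ?_, ?_⟩
  · -- (i): a 1-commutation `η` of the base functors cannot exist
    intro ι ⟨η, _⟩
    -- the component of `η` at the unique object, as an element `e` of `N_{≥1}`
    obtain ⟨e, he⟩ : ∃ e : ℕ+, η.hom.app (SingleObj.star ℕ+) = e := ⟨_, rfl⟩
    have nat := η.hom.naturality (X := SingleObj.star ℕ+) (Y := SingleObj.star ℕ+) two
    rw [he] at nat
    -- naturality at `2` reads `e · 2 = 1 · e` in `N_{≥1}`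
    change e * 2 = 1 * e at nat
    have hval := congrArg PNat.val nat
    rw [PNat.mul_coe, PNat.mul_coe, PNat.one_coe] at hval
    have h2 : ((2 : ℕ+) : ℕ) = 2 := rfl
    rw [h2] at hval
    have hpos := e.pos
    omega
  · -- (ii): `2` is a base-identity endomorphism for `S`, not for `P.ops`
    intro ⟨h, _⟩
    have h2 : P.ops.IsBaseIdentity (P.toPf.map two) := h two rfl
    change (2 : ℕ+) = 1 at h2
    exact absurd h2 (by decide)
  · -- (iii): `P.ops` is not of perfect type
    intro PP ⟨hperf, _, _⟩
    obtain ⟨B₀, φ, -, hdeg⟩ :=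
      (hperf.obj (SingleObj.star ℕ+) 2).1 (SingleObj.star ℕ+) ⟨Iso.refl _⟩
    change (1 : ℕ+) = 2 at hdeg
    exact absurd hdeg (by decide)

/-- **The universal closure of the schema `Prop32i_div` is false** (fact row F-0910, interface binders;
stated at universe level `0`, which refutes the universe-polymorphic closure a fortiori): witnessed by
`exists_junk_perfectionData`.  The printed statement is `prop32i_div_holds`.
[cite: MochizukiFrdI2008, Prop. 3.2 (i) p.58] -/
theorem not_forall_prop32i_div :
    ¬ ∀ (C : Type) [Category.{0} C] (D : Type) [Category.{0} D] (S : PreFrobenioidData.{0} C D)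
        (P : PerfectionData S) (ι : ∀ X : D, S.Mon X →* P.ops.Mon X),
        Literature.AlgebraicGeometry.Frobenioids.Prop32i_div S P ι := by
  intro h
  obtain ⟨S, P, hdiv, -, -⟩ := exists_junk_perfectionData
  exact hdiv (fun X => 1) (h _ _ S P _)

/-- **The universal closure of the schema `Prop32ii_rest` is false** (fact row F-0912, interface binders;
universe level `0`): witnessed by `exists_junk_perfectionData`.  The printed statement is
`prop32ii_rest_holds`. [cite: MochizukiFrdI2008, Prop. 3.2 (ii) p.59] -/
theorem not_forall_prop32ii_rest :
    ¬ ∀ (C : Type) [Category.{0} C] (D : Type) [Category.{0} D] (S : PreFrobenioidData.{0} C D)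
        (P : PerfectionData S), Literature.AlgebraicGeometry.Frobenioids.Prop32ii_rest S P := by
  intro h
  obtain ⟨S, P, -, hrest, -⟩ := exists_junk_perfectionData
  exact hrest (h _ _ S P)

/-- **The universal closure of the schema `Prop32iii` is false** (fact row F-0913, interface binders;
universe level `0`), even when the second perfection datum `PP` is left arbitrary: witnessed by
`exists_junk_perfectionData`.  The printed statement is `prop32iii_holds`.
[cite: MochizukiFrdI2008, Prop. 3.2 (iii) p.59] -/
theorem not_forall_prop32iii :
    ¬ ∀ (C : Type) [Category.{0} C] (D : Type) [Category.{0} D] (S : PreFrobenioidData.{0} C D)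
        (P : PerfectionData S) (PP : PerfectionData P.ops),
        Literature.AlgebraicGeometry.Frobenioids.Prop32iii S P PP := by
  intro h
  obtain ⟨S, P, -, -, hiii⟩ := exists_junk_perfectionData
  -- a perfection datum of `P.ops` to feed the closure: the identity again
  let PP : PerfectionData P.ops :=
    { Pf := P.Pf
      toPf := 𝟭 _
      root := fun A _ => A
      root_one := fun _ => rfl
      root_surjective := fun X => ⟨X, 1, rfl⟩
      ops := P.ops }
  exact hiii PP (h _ _ S P PP)

/-! ### Proposition 3.2 (i) [base and degree clauses] and (ii) [operations classes]: the two closures of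
the remaining schemata `Prop32i`, `Prop32ii` of the same trunk file (fact rows F-0909, F-0911) -/

section PrintedMain

variable {D : Type u} [Category.{v} D] {Φ : Dᵒᵖ ⥤ CommMonCat.{w}}
  {C : Type u'} [Category.{v'} C] {F : C ⥤ ElemFrobenioid Φ}

/-- **Proposition 3.2 (i), base and Frobenius-degree clauses** (fact row F-0909), closed over the printed
binders: for every Frobenioid `F : C → F_Φ`, THE functor `C → C^pf` lies over `D` and preserves Frobenius
degrees — the landed theorem `PreFrobenioid.Perfection.prop32i_perfection` BY NAME (FrdI Prop. 3.2 (i)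
p. 58).  The closure over the interface binders is false: `not_forall_prop32i`.
[cite: MochizukiFrdI2008, Prop. 3.2 (i) p.58] -/
theorem prop32i_holds (hF : PreFrobenioid.IsFrobenioid F) :
    Literature.AlgebraicGeometry.Frobenioids.Prop32i (PreFrobenioidData.ofFunctor Φ F)
      (PreFrobenioidData.perfection hF) :=
  PreFrobenioid.Perfection.prop32i_perfection hF

/-- **Proposition 3.2 (ii), the classes definable from the operations** (fact row F-0911), closed over the
printed binders: for every Frobenioid `F : C → F_Φ`, THE functor `C → C^pf` preserves arrows of Frobenius
type, pre-steps, base-isomorphisms, isometries, co-angular arrows, LB-invertible arrows and Frobenius degrees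
— the landed theorem `PreFrobenioid.Perfection.prop32ii_perfection` BY NAME (FrdI Prop. 3.2 (ii) p. 59).
The closure over the interface binders is false: `not_forall_prop32ii`.
[cite: MochizukiFrdI2008, Prop. 3.2 (ii) p.59] -/
theorem prop32ii_holds (hF : PreFrobenioid.IsFrobenioid F) :
    Literature.AlgebraicGeometry.Frobenioids.Prop32ii (PreFrobenioidData.ofFunctor Φ F)
      (PreFrobenioidData.perfection hF) :=
  PreFrobenioid.Perfection.prop32ii_perfection hF

end PrintedMain

/-- **Junk datum, continued** (same `S`, `P` as `exists_junk_perfectionData`): (i) no 1-commutation of the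
base functors exists, so `Prop32i S P` fails at its first conjunct; (ii) the arrow `2` is a base-isomorphism
for `S` (its base image is the identity) but not for `P.ops` (base functor the identity; `2` is not invertible
in `N_{≥1}`), so `Prop32ii S P` fails at its base-isomorphism conjunct.  An artefact of the axiom-free
interface `PerfectionData`. [cite: MochizukiFrdI2008, Prop. 3.2 p.58] -/
theorem exists_junk_perfectionData' :
    ∃ (S : PreFrobenioidData.{0} (SingleObj ℕ+) (SingleObj ℕ+)) (P : PerfectionData S),
      ¬ Prop32i S P ∧ ¬ Prop32ii S P := by
  -- the operations over a given base functor `B : J → J` (as in `exists_junk_perfectionData`)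
  let mk : (SingleObj ℕ+ ⥤ SingleObj ℕ+) → PreFrobenioidData.{0} (SingleObj ℕ+) (SingleObj ℕ+) :=
    fun B =>
      { base := B
        Mon := fun _ => ℕ+
        pull := fun _ => MonoidHom.id ℕ+
        pull_id := fun _ _ => rfl
        pull_comp := fun _ _ _ => rfl
        div := fun _ => 1
        degFr := fun _ => 1
        div_id := fun _ => rfl
        div_comp := fun _ _ => by simp
        degFr_id := fun _ => rfl
        degFr_comp := fun _ _ => (mul_one _).symm }
  let S := mk (1 : ℕ+ →* ℕ+).toFunctor
  let P : PerfectionData S :=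
    { Pf := SingleObj ℕ+
      toPf := 𝟭 _
      root := fun A _ => A
      root_one := fun _ => rfl
      root_surjective := fun X => ⟨X, 1, rfl⟩
      ops := mk (𝟭 _) }
  let two : SingleObj.star ℕ+ ⟶ SingleObj.star ℕ+ := (2 : ℕ+)
  refine ⟨S, P, ?_, ?_⟩
  · -- (i): a 1-commutation `η` of the base functors cannot exist
    intro ⟨⟨η⟩, _⟩
    obtain ⟨e, he⟩ : ∃ e : ℕ+, η.hom.app (SingleObj.star ℕ+) = e := ⟨_, rfl⟩
    have nat := η.hom.naturality (X := SingleObj.star ℕ+) (Y := SingleObj.star ℕ+) two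
    rw [he] at nat
    change e * 2 = 1 * e at nat
    have hval := congrArg PNat.val nat
    rw [PNat.mul_coe, PNat.mul_coe, PNat.one_coe] at hval
    have h2 : ((2 : ℕ+) : ℕ) = 2 := rfl
    rw [h2] at hval
    have hpos := e.pos
    omega
  · -- (ii): `2` is a base-isomorphism for `S`, not for `P.ops`
    intro ⟨_, _, hbi, _⟩
    have hS : S.IsBaseIso two := by
      change IsIso (𝟙 (SingleObj.star ℕ+))
      infer_instance
    have h2 : P.ops.IsBaseIso (P.toPf.map two) := hbi two hS
    change IsIso two at h2
    -- an inverse of `2` in `N_{≥1}` would satisfy `g · 2 = 1`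
    obtain ⟨g, hg⟩ : ∃ g : ℕ+, g * 2 = 1 := ⟨inv two, IsIso.hom_inv_id two⟩
    have hval := congrArg PNat.val hg
    rw [PNat.mul_coe, PNat.one_coe] at hval
    have h2' : ((2 : ℕ+) : ℕ) = 2 := rfl
    rw [h2'] at hval
    have hpos := g.pos
    omega

/-- **The universal closure of the schema `Prop32i` is false** (fact row F-0909, interface binders;
universe level `0`): witnessed by `exists_junk_perfectionData'`.  The printed statement is `prop32i_holds`.
[cite: MochizukiFrdI2008, Prop. 3.2 (i) p.58] -/
theorem not_forall_prop32i :
    ¬ ∀ (C : Type) [Category.{0} C] (D : Type) [Category.{0} D] (S : PreFrobenioidData.{0} C D)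
        (P : PerfectionData S), Literature.AlgebraicGeometry.Frobenioids.Prop32i S P := by
  intro h
  obtain ⟨S, P, hi, -⟩ := exists_junk_perfectionData'
  exact hi (h _ _ S P)

/-- **The universal closure of the schema `Prop32ii` is false** (fact row F-0911, interface binders;
universe level `0`): witnessed by `exists_junk_perfectionData'`.  The printed statement is `prop32ii_holds`.
[cite: MochizukiFrdI2008, Prop. 3.2 (ii) p.59] -/
theorem not_forall_prop32ii :
    ¬ ∀ (C : Type) [Category.{0} C] (D : Type) [Category.{0} D] (S : PreFrobenioidData.{0} C D)
        (P : PerfectionData S), Literature.AlgebraicGeometry.Frobenioids.Prop32ii S P := by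
  intro h
  obtain ⟨S, P, -, hii⟩ := exists_junk_perfectionData'
  exact hii (h _ _ S P)

end Literature.AlgebraicGeometry.Frobenioids
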